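import Mathlib
import Summits.Ventures.PercRepro2.TypedStarGenK5
import Summits.Ventures.PercRepro2.TypedStarCore

/-!
# The one-star class of any degree, subtracted from the core modulo the `K₅` star certificates
(blind cell PercRepro2, p2 g2, 2026-08-25; sub-claim S1 (C), the degree-`≥ 4` complement of
`OneStar`)

`OneStarGen`: the typed graph has exactly one unmarked typed vertex `u`, all of whose typed edges
(a list `L`, at least four) go to marks; every other typed edge joins two marks.  On a fully reduced
instance with `MarksDistinct` marks, `typedCount_K3_patch` (TypedStarGenK5.lean) writes the typed
base as the `K₅`-side placement sum at the image marking, so row 2′TRI on the class follows from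
`StarNonnegGen` at the finitely many (marking, star list) — the hypothesis **`StarCertsGen R`**
(typer-1's certificates of degree `4` and `5`: `81` / `243` placements, mine-1's §24(i) groups).

* **`typedCount_nonneg_of_oneStarGen (hS : StarCertsGen R)`** — row 2′TRI on the class;
* **`ResidualCoreG := ResidualCoreS ∧ ¬ OneStarGen`**,
  **`HCov_all_of_residualCoreG_all (h3 : StarCerts R) (h4 : StarCertsGen R) : ResidualCoreG_all R →
  HCov_all R`** — CONDITIONAL on both certificate bundles; what remains in `ResidualCoreG` has at
  least two unmarked typed vertices (the adjacency residual and beyond).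

Own code; standard axioms.
-/

namespace Summit.Ventures.PercRepro2

open UnionCluster

namespace CovForm

namespace TypedRed

/-! ## The class -/

section OneStarGen

variable {V : Type*} {E : Type*}

/-- **The one-star class of degree `≥ 4`**: an unmarked vertex `u`, a list `L` (no repetition, at least
four edges) of typed edges `u–nbr e` to marks, every other typed edge joining two marks. -/
def OneStarGen (ends : E → Sym2 V) (o a₁ a₂ a₃ b : V) (F : Finset E) : Prop :=
  ∃ (u : V) (nbr : E → V) (L : List E),
    (u ≠ o ∧ u ≠ a₁ ∧ u ≠ a₂ ∧ u ≠ a₃ ∧ u ≠ b) ∧ L.Nodup ∧ 4 ≤ L.length ∧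
    (∀ e ∈ L, e ∈ F ∧ ends e = s(u, nbr e) ∧
      (nbr e = o ∨ nbr e = a₁ ∨ nbr e = a₂ ∨ nbr e = a₃ ∨ nbr e = b)) ∧
    (∀ e ∈ F, e ∉ L → ∀ v ∈ ends e, v = o ∨ v = a₁ ∨ v = a₂ ∨ v = a₃ ∨ v = b)

end OneStarGen

/-! ## The certificates -/

section Certs

variable (R : Type*) [Field R] [LinearOrder R]

/-- **The `K₅` star certificates of degree `≥ 4`**: `StarNonnegGen` at the three markings for every
star list of distinct marks with types in `{1, 2}` and at least four edges. -/
def StarCertsGen : Prop :=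
  ∀ b : Fin 5, (b = 4 ∨ b = 3 ∨ b = 0) → ∀ L : List (Fin 5 × ℕ),
    (∀ x ∈ L, (x.1 = 0 ∨ x.1 = 1 ∨ x.1 = 2 ∨ x.1 = 3 ∨ x.1 = b) ∧ (x.2 = 1 ∨ x.2 = 2)) →
    (L.map Prod.fst).Nodup → 4 ≤ L.length → K5.StarNonnegGen R 0 1 2 3 b L

end Certs

/-! ## Row 2′TRI on the class -/

section Theorem

variable {V : Type*} {E : Type*} [Fintype E] [DecidableEq E] [DecidableEq V]
variable {R : Type*} [Field R] [LinearOrder R]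

/-- **Row 2′TRI on the one-star class of degree `≥ 4`**, on loop-free parallel-free typed graphs with
`MarksDistinct` marks and mixed types, from the certificates. -/
theorem typedCount_nonneg_of_oneStarGen (hS : StarCertsGen R) (ends : E → Sym2 V) (o a₁ a₂ a₃ b : V)
    (F : Finset E) (τ : E → ℕ) (hτ : ∀ e ∈ F, τ e = 1 ∨ τ e = 2) (hm : MarksDistinct o a₁ a₂ a₃ b)
    (hloop : ∀ f ∈ F, ¬ (ends f).IsDiag) (hpar : ∀ e ∈ F, ∀ f ∈ F, e ≠ f → ends e ≠ ends f)
    (h : OneStarGen ends o a₁ a₂ a₃ b F) :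
    0 ≤ typedCount F (fun _ => false) τ (K3 ends o a₁ a₂ a₃ b : Config E → Config E → Config E → R) := by
  obtain ⟨u, nbr, L, ⟨huo, hu1, hu2, hu3, hub⟩, hnd, hlen, hL, hall⟩ := h
  obtain ⟨⟨ha12, ha31, ha32, ho1, ho2, hb1, hb2⟩, ho3⟩ := hm
  set M : Set V := K5.marks o a₁ a₂ a₃ b with hM
  have hmem : ∀ v, (v = o ∨ v = a₁ ∨ v = a₂ ∨ v = a₃ ∨ v = b) ↔ v ∈ M := by
    intro v
    simp [hM, K5.marks]
  have hu : u ∉ M := by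
    rw [← hmem]
    rintro (h | h | h | h | h)
    · exact huo h
    · exact hu1 h
    · exact hu2 h
    · exact hu3 h
    · exact hub h
  have hs : K5.StarL ends M u nbr L :=
    ⟨hu, fun e he => ⟨(hL e he).2.1, (hmem _).1 (hL e he).2.2⟩, hnd⟩
  set F₀ := F.filter (fun e => e ∉ L) with hF₀
  have hF₀sub : ∀ e ∈ F₀, e ∈ F ∧ e ∉ L := fun e he => Finset.mem_filter.1 he
  have hMF : ∀ e ∈ F₀, ∀ v ∈ ends e, v ∈ M := by
    intro e he v hv
    obtain ⟨heF, heL⟩ := hF₀sub e he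
    exact (hmem v).1 (hall e heF heL v hv)
  have hinj : Set.InjOn (K5.markMap o a₁ a₂ a₃ b) M :=
    K5.markMap_injOn ha12 ha31 ha32 ho1 ho2 hb1 hb2 ho3
  have hMk : ∀ v ∈ M, v = o ∨ v = a₁ ∨ v = a₂ ∨ v = a₃ ∨ v = b := fun v hv => (hmem v).2 hv
  refine K5.typedCount_K3_nonneg_of_gen (K5.markMap o a₁ a₂ a₃ b) ends F hinj hs (fun e he => (hL e he).1)
    hMF (fun e he => hloop e (hF₀sub e he).1)
    (fun e he e' he' hee' => by
      by_contra hne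
      exact hpar e (hF₀sub e he).1 e' (hF₀sub e' he').1 hne hee')
    ((hmem o).1 (Or.inl rfl)) ((hmem a₁).1 (Or.inr (Or.inl rfl)))
    ((hmem a₂).1 (Or.inr (Or.inr (Or.inl rfl)))) ((hmem a₃).1 (Or.inr (Or.inr (Or.inr (Or.inl rfl)))))
    ((hmem b).1 (Or.inr (Or.inr (Or.inr (Or.inr rfl))))) hMk τ ?_
  rw [K5.markMap_o, K5.markMap_a₁ ho1, K5.markMap_a₂ ha12 ho2, K5.markMap_a₃ ha31 ha32 ho3]
  -- the neighbours are distinct (no parallel typed edges)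
  have hnbr_inj : ∀ e ∈ L, ∀ e' ∈ L, K5.markMap o a₁ a₂ a₃ b (nbr e) = K5.markMap o a₁ a₂ a₃ b (nbr e') →
      e = e' := by
    intro e he e' he' hmm
    have hv : nbr e = nbr e' := hinj ((hmem _).1 (hL e he).2.2) ((hmem _).1 (hL e' he').2.2) hmm
    by_contra hne
    exact hpar e (hL e he).1 e' (hL e' he').1 hne (by rw [(hL e he).2.1, (hL e' he').2.1, hv])
  refine hS _ (K5.markMap_b ha31 ha32 hb1 hb2 ho3) _ ?_ ?_ ?_
  · intro x hx
    obtain ⟨e, he, rfl⟩ := List.mem_map.1 hx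
    exact ⟨markMap_mem ha12 ha31 ha32 ho1 ho2 ho3 (hL e he).2.2, hτ e (hL e he).1⟩
  · rw [List.map_map]
    exact hnd.map_on fun e he e' he' h => hnbr_inj e he e' he' h
  · rw [List.length_map]; exact hlen

end Theorem

/-! ## The conjunct in the core -/

section Core

variable {V : Type*} {E : Type*} [DecidableEq V] [Fintype E] [DecidableEq E]

/-- **The core without a root cut, without a one-star of degree `3`, without a one-star of degree
`≥ 4`** — what remains has at least two unmarked typed vertices. -/
structure ResidualCoreG (ends : E → Sym2 V) (o a₁ a₂ a₃ b : V) (F : Finset E) : Prop where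
  coreS : ResidualCoreS ends o a₁ a₂ a₃ b F
  not_oneStarGen : ¬ OneStarGen ends o a₁ a₂ a₃ b F

end Core

section Closure

variable (R : Type*) [Field R] [LinearOrder R] [IsStrictOrderedRing R]

/-- **Row 2′TRI on `ResidualCoreG`, over every finite graph.** -/
def ResidualCoreG_all : Prop :=
  ∀ (V E : Type) [Fintype V] [DecidableEq V] [Fintype E] [DecidableEq E]
    (ends : E → Sym2 V) (o a₁ a₂ a₃ b : V) (F : Finset E) (τ : E → ℕ),
    (∀ e ∈ F, τ e = 1 ∨ τ e = 2) → ResidualCoreG ends o a₁ a₂ a₃ b F →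
      0 ≤ typedCount F (fun _ => false) τ
        (K3 ends o a₁ a₂ a₃ b : Config E → Config E → Config E → R)

/-- **CONDITIONAL on both certificate bundles: the crux of record from (TRI) on the core instances
with at least two unmarked typed vertices (or a root cut / a one-star already excluded).** -/
theorem HCov_all_of_residualCoreG_all (h3 : StarCerts R) (h4 : StarCertsGen R)
    (hc : ResidualCoreG_all R) : HCov_all R := by
  refine HCov_all_of_residualCoreS_all R h3 ?_
  intro V E _ _ _ _ ends o a₁ a₂ a₃ b F τ hτ hcore
  by_cases hstar : OneStarGen ends o a₁ a₂ a₃ b F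
  · have hred := hcore.coreC.core.residualConR.residualCon.residual.reduced
    exact typedCount_nonneg_of_oneStarGen h4 ends o a₁ a₂ a₃ b F τ hτ hcore.coreC.core.marks
      hred.no_loop hred.no_parallel hstar
  · exact hc V E ends o a₁ a₂ a₃ b F τ hτ ⟨hcore, hstar⟩

end Closure

end TypedRed

end CovForm

end Summit.Ventures.PercRepro2
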